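import Mathlib.Analysis.Analytic.Binomial
import Mathlib.Analysis.SpecificLimits.Normed
import Mathlib.RingTheory.PowerSeries.Binomial
import Mathlib.Analysis.Normed.Ring.InfiniteSum
import HarnessLib

/-!
# Evaluation and tail estimate for `∏ (1 + a_i T)^{r_i}` [Schoof2009, Proposition 12.1 (iii)]

The analytic half of [Schoof2009, Proposition 12.1] for the power series
`F(T) = ∏_{i∈s} (1 + a_i T)^{r_i} ∈ ℂ⟦T⟧` (`PowerSeries.binomialSeries`, rescaled; in
[Schoof2009, Chapter 12] `a_σ = -φ(σ(ζ_p))`, `r_σ = n_σ/q`):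

* `Catalan.Plus.hasSum_coeff_prod_rescale_binomialSeries` — for `‖a_i‖ ≤ 1` and `‖z‖ < 1` the series
  `∑_k [T^k]F · z^k` converges absolutely to `∏_i (1 + a_i z)^{r_i}` (complex powers, principal
  branch): substitution is multiplicative (Cauchy products);
* `Catalan.Plus.norm_coeff_prod_le` — the majorant of [Schoof2009, Prop. 12.1 (iii)]: for real
  `r_i ≥ 0`, `‖[T^k] F‖ ≤ [T^k] (1 - T)^{-∑ r_i}` ([Schoof2009, Exercise 12.1 (a)]);
* `Catalan.Plus.norm_sub_sum_le` — **[Schoof2009, Proposition 12.1 (iii)]** (with `k = m`): if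
  `∑ r_i = m ≥ 1` then `‖F(z) - F_m(z)‖ ≤ C(2m, m+1) ‖z‖^{m+1}/(1 - ‖z‖)^{2m+1}`, where `F_m` is the
  sum of the terms of degree `≤ m` (`|C(-m, m+1)| = C(2m, m+1)`, [Schoof2009, Lemma 5.1]).

Second file of the formalisation of [Schoof2009, Chapter 12] (after `CatalanPlusSeries`).
Everything is proved; no definitions.

## References

* R. Schoof, *Catalan's Conjecture*, Universitext, Springer 2009 [Schoof2009], Proposition 12.1
  (iii), Lemma 5.1, Exercises 5.8, 12.1 (book pp. 77–78, 23) — held,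
  `lit read book:schoof2009-catalan-s-conjecture` (PDF pp. 157–158).
* P. Mihăilescu, *Primary cyclotomic units and a proof of Catalan's conjecture*, J. reine angew.
  Math. **572** (2004), 167–195 [Mihailescu2004].
-/

namespace Literature.NumberTheory.DiophantineGeometry

namespace Catalan.Plus

open Finset PowerSeries

open scoped Nat

/-! ### Substituting `T = z`: absolute convergence and multiplicativity -/

/-- `‖z‖ < 1 ⟹ z` lies in the unit `eball`. [folklore] -/
theorem mem_eball_of_norm_lt {z : ℂ} {r : ENNReal} (hz : ‖z‖ < 1) (hr : 1 ≤ r) :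
    z ∈ Metric.eball (0 : ℂ) r := by
  rw [Metric.mem_eball, edist_zero_right, ← ofReal_norm]
  exact lt_of_lt_of_le (ENNReal.ofReal_lt_one.mpr hz) hr

/-- **The binomial series** `∑_k C(r,k) (az)^k = (1 + az)^r` for `‖az‖ < 1`, absolutely
(Mathlib's `Complex.one_add_cpow_hasFPowerSeriesOnBall_zero`). [folklore] -/
theorem hasSum_coeff_rescale_binomialSeries (a r : ℂ) {z : ℂ} (hz : ‖a * z‖ < 1) :
    HasSum (fun k => coeff k (rescale a (PowerSeries.binomialSeries ℂ r)) * z ^ k) ((1 + a * z) ^ r) ∧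
      Summable fun k => ‖coeff k (rescale a (PowerSeries.binomialSeries ℂ r)) * z ^ k‖ := by
  have hterm : ∀ k, _root_.binomialSeries ℂ r k (fun _ => a * z) =
      coeff k (rescale a (PowerSeries.binomialSeries ℂ r)) * z ^ k := by
    intro k
    rw [binomialSeries_apply, List.prod_ofFn, Fin.prod_const, smul_eq_mul, coeff_rescale,
      binomialSeries_coeff, smul_eq_mul, mul_one, mul_pow]
    ring
  constructor
  · have h := (Complex.one_add_cpow_hasFPowerSeriesOnBall_zero (a := r)).hasSum
      (mem_eball_of_norm_lt hz le_rfl)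
    simp only [zero_add] at h
    simpa only [hterm] using h
  · have h := (_root_.binomialSeries ℂ r).summable_norm_apply
      (mem_eball_of_norm_lt hz binomialSeries_radius_ge_one)
    simpa only [hterm] using h

/-- Substitution of `z` into the constant series `1`. [folklore] -/
theorem hasSum_coeff_one (z : ℂ) :
    HasSum (fun k => coeff k (1 : ℂ⟦X⟧) * z ^ k) 1 ∧
      Summable fun k => ‖coeff k (1 : ℂ⟦X⟧) * z ^ k‖ := by
  have h1 : (fun k => coeff k (1 : ℂ⟦X⟧) * z ^ k) = fun k => if k = 0 then (1 : ℂ) else 0 := by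
    funext k
    rw [coeff_one]
    split_ifs with h
    · rw [h, pow_zero, mul_one]
    · rw [zero_mul]
  have h2 : (fun k => ‖coeff k (1 : ℂ⟦X⟧) * z ^ k‖) = fun k => if k = 0 then (1 : ℝ) else 0 := by
    funext k
    rw [congrFun h1 k]
    split_ifs <;> simp
  rw [h1, h2]
  exact ⟨hasSum_ite_eq 0 1, (hasSum_ite_eq 0 (1 : ℝ)).summable⟩

/-- **Substitution is multiplicative** on absolutely convergent series (Cauchy product).
[folklore] -/
theorem hasSum_coeff_mul {S T : ℂ⟦X⟧} {z A B : ℂ}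
    (hS : HasSum (fun k => coeff k S * z ^ k) A) (hS' : Summable fun k => ‖coeff k S * z ^ k‖)
    (hT : HasSum (fun k => coeff k T * z ^ k) B) (hT' : Summable fun k => ‖coeff k T * z ^ k‖) :
    HasSum (fun k => coeff k (S * T) * z ^ k) (A * B) ∧
      Summable fun k => ‖coeff k (S * T) * z ^ k‖ := by
  have hterm : ∀ k, coeff k (S * T) * z ^ k =
      ∑ ij ∈ antidiagonal k, coeff ij.1 S * z ^ ij.1 * (coeff ij.2 T * z ^ ij.2) := by
    intro k
    rw [coeff_mul, sum_mul]
    refine sum_congr rfl fun ij hij => ?_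
    rw [← mem_antidiagonal.mp hij, pow_add]
    ring
  have hsum : Summable fun k => ‖coeff k (S * T) * z ^ k‖ := by
    simpa only [hterm] using summable_norm_sum_mul_antidiagonal_of_summable_norm hS' hT'
  refine ⟨?_, hsum⟩
  have h1 := (hsum.of_norm).hasSum
  have h2 : ∑' k, coeff k (S * T) * z ^ k = A * B := by
    simp only [hterm]
    rw [← tsum_mul_tsum_eq_tsum_sum_antidiagonal_of_summable_norm hS' hT', hS.tsum_eq, hT.tsum_eq]
  rwa [h2] at h1

/-- Substitution into finite products. [folklore] -/
theorem hasSum_coeff_prod {ι : Type*} (s : Finset ι) (S : ι → ℂ⟦X⟧) (F : ι → ℂ) {z : ℂ}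
    (h : ∀ i ∈ s, HasSum (fun k => coeff k (S i) * z ^ k) (F i) ∧
      Summable fun k => ‖coeff k (S i) * z ^ k‖) :
    HasSum (fun k => coeff k (∏ i ∈ s, S i) * z ^ k) (∏ i ∈ s, F i) ∧
      Summable fun k => ‖coeff k (∏ i ∈ s, S i) * z ^ k‖ := by
  classical
  induction s using Finset.induction_on with
  | empty => rw [prod_empty, prod_empty]; exact hasSum_coeff_one z
  | insert i s hi ih =>
    rw [prod_insert hi, prod_insert hi]
    have h1 := h i (mem_insert_self i s)
    have h2 := ih fun j hj => h j (mem_insert_of_mem hj)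
    exact hasSum_coeff_mul h1.1 h1.2 h2.1 h2.2

/-- **[Schoof2009, Proposition 12.1 (iii), convergence]**: for `‖a_i‖ ≤ 1` and `‖z‖ < 1`,
`∑_k [T^k](∏_i (1 + a_i T)^{r_i}) z^k = ∏_i (1 + a_i z)^{r_i}`, absolutely.
[cite: Schoof2009, Proposition 12.1 (iii)] -/
theorem hasSum_coeff_prod_rescale_binomialSeries {ι : Type*} (s : Finset ι) (a r : ι → ℂ)
    (ha : ∀ i ∈ s, ‖a i‖ ≤ 1) {z : ℂ} (hz : ‖z‖ < 1) :
    HasSum (fun k => coeff k (∏ i ∈ s, rescale (a i) (PowerSeries.binomialSeries ℂ (r i))) * z ^ k)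
        (∏ i ∈ s, (1 + a i * z) ^ (r i)) ∧
      Summable fun k =>
        ‖coeff k (∏ i ∈ s, rescale (a i) (PowerSeries.binomialSeries ℂ (r i))) * z ^ k‖ := by
  refine hasSum_coeff_prod s _ _ fun i hi => hasSum_coeff_rescale_binomialSeries (a i) (r i) ?_
  calc ‖a i * z‖ = ‖a i‖ * ‖z‖ := norm_mul _ _
    _ ≤ 1 * ‖z‖ := by gcongr; exact ha i hi
    _ < 1 := by rw [one_mul]; exact hz

/-! ### The majorant `(1 - T)^{-∑ r_i}` [Schoof2009, Exercise 12.1, Prop. 12.1 (iii)] -/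

/-- **[Schoof2009, Exercise 12.1 (a)]** for `x ≥ 0`: `|C(x, k)| ≤ (-1)^k C(-x, k) = ∏ (x+j)/k!`.
[cite: Schoof2009, Exercise 12.1 (a)] -/
theorem abs_ring_choose_le {x : ℝ} (hx : 0 ≤ x) (k : ℕ) :
    |Ring.choose x k| ≤ (-1) ^ k * Ring.choose (-x) k := by
  have h1 : ∀ y : ℝ, Ring.choose y k = (∏ j ∈ range k, (y - j)) / k ! := by
    intro y
    rw [Ring.choose_eq_smul, ← Polynomial.aeval_eq_smeval, Polynomial.aeval_def,
      Polynomial.eval₂_eq_eval_map, descPochhammer_map, descPochhammer_eval_eq_prod_range,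
      smul_eq_mul, div_eq_inv_mul]
  rw [h1, h1, abs_div, Nat.abs_cast, mul_div_assoc', ← card_range k, ← prod_const, card_range,
    ← prod_mul_distrib, abs_prod]
  gcongr with j hj
  rw [abs_le]
  constructor <;> nlinarith [(Nat.cast_nonneg j : (0 : ℝ) ≤ j)]

/-- The coefficients of the majorant series `(1 - T)^{-x} = ∑ (-1)^k C(-x,k) T^k`. [folklore] -/
theorem coeff_rescale_neg_one_binomialSeries (x : ℝ) (k : ℕ) :
    coeff k (rescale (-1 : ℝ) (PowerSeries.binomialSeries ℝ (-x))) = (-1) ^ k * Ring.choose (-x) k := by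
  rw [coeff_rescale, binomialSeries_coeff, smul_eq_mul, mul_one]

/-- Majorisation is stable under products: if `‖[T^k]S‖ ≤ [T^k]M` and `‖[T^k]T‖ ≤ [T^k]N` for all `k`
then `‖[T^k](ST)‖ ≤ [T^k](MN)`. [folklore] -/
theorem norm_coeff_mul_le {S T : ℂ⟦X⟧} {M N : ℝ⟦X⟧} (hS : ∀ k, ‖coeff k S‖ ≤ coeff k M)
    (hT : ∀ k, ‖coeff k T‖ ≤ coeff k N) (k : ℕ) : ‖coeff k (S * T)‖ ≤ coeff k (M * N) := by
  rw [coeff_mul, coeff_mul]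
  refine (norm_sum_le _ _).trans (sum_le_sum fun ij _ => ?_)
  rw [norm_mul]
  exact mul_le_mul (hS _) (hT _) (norm_nonneg _) ((norm_nonneg _).trans (hS _))

/-- Majorisation of finite products. [folklore] -/
theorem norm_coeff_prod_le {ι : Type*} (s : Finset ι) (S : ι → ℂ⟦X⟧) (M : ι → ℝ⟦X⟧)
    (h : ∀ i ∈ s, ∀ k, ‖coeff k (S i)‖ ≤ coeff k (M i)) (k : ℕ) :
    ‖coeff k (∏ i ∈ s, S i)‖ ≤ coeff k (∏ i ∈ s, M i) := by
  classical
  induction s using Finset.induction_on generalizing k with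
  | empty =>
    rw [prod_empty, prod_empty, coeff_one, coeff_one]
    split_ifs <;> simp
  | insert i s hi ih =>
    rw [prod_insert hi, prod_insert hi]
    exact norm_coeff_mul_le (h i (mem_insert_self i s)) (fun k => ih (fun j hj => h j
      (mem_insert_of_mem hj)) k) k

/-- The binomial series of a finite sum of exponents is the product. [folklore] -/
theorem binomialSeries_sum {ι : Type*} (s : Finset ι) (x : ι → ℝ) :
    PowerSeries.binomialSeries ℝ (∑ i ∈ s, x i) = ∏ i ∈ s, PowerSeries.binomialSeries ℝ (x i) := by
  classical
  induction s using Finset.induction_on with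
  | empty => rw [sum_empty, prod_empty, binomialSeries_zero]
  | insert i s hi ih => rw [sum_insert hi, prod_insert hi, binomialSeries_add, ih]

/-- **[Schoof2009, Proposition 12.1 (iii), majorant]**: for `‖a_i‖ ≤ 1` and real `r_i ≥ 0` the
coefficients of `∏_i (1 + a_i T)^{r_i}` are bounded in absolute value by those of
`(1 - T)^{-∑ r_i}`. [cite: Schoof2009, Proposition 12.1 (iii)] -/
theorem norm_coeff_prod_rescale_binomialSeries_le {ι : Type*} (s : Finset ι) (a : ι → ℂ)
    (x : ι → ℝ) (ha : ∀ i ∈ s, ‖a i‖ ≤ 1) (hx : ∀ i ∈ s, 0 ≤ x i) (k : ℕ) :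
    ‖coeff k (∏ i ∈ s, rescale (a i) (PowerSeries.binomialSeries ℂ ((x i : ℝ) : ℂ)))‖ ≤
      (-1) ^ k * Ring.choose (-∑ i ∈ s, x i) k := by
  have h := norm_coeff_prod_le s (fun i => rescale (a i) (PowerSeries.binomialSeries ℂ ((x i : ℝ) : ℂ)))
    (fun i => rescale (-1 : ℝ) (PowerSeries.binomialSeries ℝ (-x i))) ?_ k
  · rwa [← map_prod, ← binomialSeries_sum, sum_neg_distrib,
      coeff_rescale_neg_one_binomialSeries] at h
  intro i hi k
  rw [coeff_rescale_neg_one_binomialSeries, coeff_rescale, binomialSeries_coeff, smul_eq_mul,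
    mul_one, norm_mul, norm_pow, ← Complex.ofReal_choose, Complex.norm_real, Real.norm_eq_abs]
  calc ‖a i‖ ^ k * |Ring.choose (x i) k| ≤ 1 ^ k * |Ring.choose (x i) k| := by
        gcongr; exact ha i hi
    _ ≤ (-1) ^ k * Ring.choose (-x i) k := by rw [one_pow, one_mul]; exact abs_ring_choose_le (hx i hi) k

/-- For a natural exponent `m ≥ 1`: `(-1)^k C(-m, k) = C(m+k-1, k)`. [folklore] -/
theorem neg_one_pow_mul_ring_choose_neg_nat (m k : ℕ) (hm : 1 ≤ m) :
    (-1 : ℝ) ^ k * Ring.choose (-(m : ℝ)) k = ((m + k - 1).choose k : ℝ) := by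
  have h1 : Ring.choose (-(m : ℝ)) k = (∏ j ∈ range k, (-(m : ℝ) - j)) / k ! := by
    rw [Ring.choose_eq_smul, ← Polynomial.aeval_eq_smeval, Polynomial.aeval_def,
      Polynomial.eval₂_eq_eval_map, descPochhammer_map, descPochhammer_eval_eq_prod_range,
      smul_eq_mul, div_eq_inv_mul]
  obtain ⟨m', rfl⟩ : ∃ m', m = m' + 1 := ⟨m - 1, by omega⟩
  have h2 : ((m' + 1 + k - 1).choose k : ℝ) = (∏ j ∈ range k, ((m' : ℝ) + 1 + j)) / k ! := by
    rw [eq_div_iff (Nat.cast_ne_zero.mpr (Nat.factorial_ne_zero k)), show m' + 1 + k - 1 = m' + k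
      by omega]
    have := Nat.ascFactorial_eq_factorial_mul_choose m' k
    rw [Nat.ascFactorial_eq_prod_range] at this
    have h3 := congrArg (Nat.cast : ℕ → ℝ) this
    push_cast at h3
    linear_combination -h3
  rw [h1, h2, mul_div_assoc', ← card_range k, ← prod_const, card_range, ← prod_mul_distrib]
  congr 1
  refine prod_congr rfl fun j _ => ?_
  push_cast
  ring

/-! ### The tail estimate [Schoof2009, Proposition 12.1 (iii)] -/

/-- `C(2m + j, m + 1 + j) ≤ C(2m, m+1) C(2m + j, 2m)` (`m ≥ 1`): from
`C(2m+j, 2m) C(2m, m-1) = C(2m+j, m-1) C(m+1+j, m+1)`. [cite: Schoof2009, Exercise 5.8] -/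
theorem choose_add_le (m j : ℕ) (hm : 1 ≤ m) :
    (2 * m + j).choose (m + 1 + j) ≤ (2 * m).choose (m + 1) * (2 * m + j).choose (2 * m) := by
  have h1 : (2 * m + j).choose (m + 1 + j) = (2 * m + j).choose (m - 1) := by
    rw [← Nat.choose_symm (by omega : m + 1 + j ≤ 2 * m + j)]
    congr 1
    omega
  have h2 : (2 * m).choose (m + 1) = (2 * m).choose (m - 1) := by
    rw [← Nat.choose_symm (by omega : m + 1 ≤ 2 * m)]
    congr 1
    omega
  have h3 := Nat.choose_mul (n := 2 * m + j) (k := 2 * m) (s := m - 1) (by omega)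
  rw [h1, h2, mul_comm ((2 * m).choose (m - 1)), h3]
  exact Nat.le_mul_of_pos_right _ (Nat.choose_pos (by omega))

/-- **[Schoof2009, Proposition 12.1 (iii)]** (tail estimate, with `k = m = ∑ r_i ≥ 1`): for
`‖a_i‖ ≤ 1`, real `r_i ≥ 0` with `∑ r_i = m` and `‖z‖ < 1`,
`‖∏_i (1 + a_i z)^{r_i} - ∑_{k ≤ m} [T^k]F z^k‖ ≤ C(2m, m+1) ‖z‖^{m+1}/(1 - ‖z‖)^{2m+1}`.
[cite: Schoof2009, Proposition 12.1 (iii)] -/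
theorem norm_sub_sum_le {ι : Type*} (s : Finset ι) (a : ι → ℂ) (x : ι → ℝ)
    (ha : ∀ i ∈ s, ‖a i‖ ≤ 1) (hx : ∀ i ∈ s, 0 ≤ x i) {m : ℕ} (hm : 1 ≤ m)
    (hsum : ∑ i ∈ s, x i = m) {z : ℂ} (hz : ‖z‖ < 1) :
    ‖(∏ i ∈ s, (1 + a i * z) ^ ((x i : ℝ) : ℂ)) -
        ∑ k ∈ range (m + 1), coeff k (∏ i ∈ s, rescale (a i) (PowerSeries.binomialSeries ℂ ((x i : ℝ) : ℂ)))
          * z ^ k‖ ≤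
      ((2 * m).choose (m + 1) : ℝ) * ‖z‖ ^ (m + 1) / (1 - ‖z‖) ^ (2 * m + 1) := by
  set S := ∏ i ∈ s, rescale (a i) (PowerSeries.binomialSeries ℂ ((x i : ℝ) : ℂ)) with hS
  obtain ⟨hF, -⟩ := hasSum_coeff_prod_rescale_binomialSeries s a (fun i => ((x i : ℝ) : ℂ)) ha hz
  have htail := (hasSum_nat_add_iff' (m + 1)).mpr hF
  -- termwise bound by `C(2m, m+1) ‖z‖^{m+1} · C(2m + j, 2m) ‖z‖^j`
  have hbound : ∀ j, ‖coeff (j + (m + 1)) S * z ^ (j + (m + 1))‖ ≤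
      ((2 * m).choose (m + 1) : ℝ) * ‖z‖ ^ (m + 1) * (((j + 2 * m).choose (2 * m) : ℝ) * ‖z‖ ^ j) := by
    intro j
    rw [norm_mul, norm_pow]
    have h1 := norm_coeff_prod_rescale_binomialSeries_le s a x ha hx (j + (m + 1))
    rw [hsum, neg_one_pow_mul_ring_choose_neg_nat m _ hm,
      show m + (j + (m + 1)) - 1 = 2 * m + j by omega] at h1
    have h2 : ((2 * m + j).choose (j + (m + 1)) : ℝ) ≤
        ((2 * m).choose (m + 1) : ℝ) * ((j + 2 * m).choose (2 * m) : ℝ) := by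
      rw [show j + (m + 1) = m + 1 + j by omega, add_comm j (2 * m)]
      exact_mod_cast choose_add_le m j hm
    calc ‖coeff (j + (m + 1)) S‖ * ‖z‖ ^ (j + (m + 1))
        ≤ ((2 * m + j).choose (j + (m + 1)) : ℝ) * ‖z‖ ^ (j + (m + 1)) := by gcongr
      _ ≤ ((2 * m).choose (m + 1) : ℝ) * ((j + 2 * m).choose (2 * m) : ℝ) * ‖z‖ ^ (j + (m + 1)) := by
          gcongr
      _ = _ := by ring
  have hgeom := (hasSum_choose_mul_geometric_of_norm_lt_one (2 * m)
    (show ‖(‖z‖ : ℝ)‖ < 1 by rwa [Real.norm_eq_abs, abs_norm])).mul_left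
    (((2 * m).choose (m + 1) : ℝ) * ‖z‖ ^ (m + 1))
  have := htail.norm_le_of_bounded hgeom hbound
  rw [one_div, ← div_eq_mul_inv] at this
  exact this

end Catalan.Plus

end Literature.NumberTheory.DiophantineGeometry
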